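import Summits.QuantumFields.QCD.Theses.SpectralDefectExtinction
import Literature.MathematicalPhysics.QuantumLattice.OverlapLocality
import Literature.Probability.LatticeModels.TorusFourierProofs

/-!
# Disproof of `TipNoBinding` — findings (cdisprove seat refuter-cdisprove-stmt-QuantumFields-8965-0, 2026-08-16)

Crux `Summit.QuantumFields.QCD.Theses.SpectralDefectExtinction.TipNoBinding` (item stmt-QuantumFields-8965):
`∀ R, ∃ λ > 0, ∃ L₀, ∀ L ≥ L₀, ∀ SU(3) fields U trivial on links based outside the image of {−R..R}⁴,
 ∀ t ∈ [1/√L, λ): det (D_W(U,0,1) − t) ≠ 0`.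

## Verdict so far: NO KILL — the crux is true; a proof line is being executed
(picked line `positivity-no-leak-spread`: 3 of 6 stubs landed at 2026-08-16T01:00Z — positivity, Sobolev sup,
perturbation; open: diamagnetic, greenBound, noLeak — each re-derived by this seat with its exact constants: hold)
* WHY IT RESISTS.  A real eigenvalue `t` of `D = D_W(U,0,1)` with eigenvector `ψ` satisfies
  `t‖ψ‖² = Re⟨ψ,Dψ⟩ = ½ Σ_{x,μ} ‖U(x,μ)ψ(x+μ̂) − ψ(x)‖²` (Wilson positivity, landed:
  `Theorems/SpectralDefectExtinctionTipNoBindingStubPositivity.lean`), so small `t` forces `|ψ|` to be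
  almost covariantly constant, hence SPREAD over the torus (`|ψ(x)|² ≤ (2/L⁴ + 4K t)‖ψ‖²`, Kato + the d = 4
  Sobolev sup bound, landed: `…StubSobolevSup.lean`), while the eigen-equation `(D₀ − t)ψ = −Bψ` with `B`
  supported on `≤ 5(2R+1)⁴` sites (landed: `…StubPerturbation.lean`) and the free resolvent bound off the
  zero mode (`stub_noLeak`, the floor `t ≥ 1/√L` pays for the zero-mode pole `1/t² ≤ L`) force
  `‖ψ‖² ≲ |S|²·max_x |ψ(x)|²`, i.e. CONCENTRATION near the box.  Spread × concentration is contradictory for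
  `L⁴ ≫ 1` and `t ≪ 1`.  Equivalent infinite-volume content: no finite SU(3) cluster has a threshold
  (t = 0⁺) resonance, because threshold solutions are ℓ²(ℤ⁴) in d = 4 and ℓ² zero modes are killed by
  positivity.  Every attack below is consistent with this.
* ATTACKS THAT FAILED (details in the docstrings): degenerate boxes (R with 2R+1 ≥ L: absorbed by L₀);
  t = 0 / t < 0 (excluded by the floor / by positivity); constant abelian or centre backgrounds in the box
  (real eigenvalues only at W ∈ {0,2,4,6,8} up to O(L⁻⁴) shifts); Hermitian-link stars, U(1)- and
  SU(2)-embedded hedgehogs, Haar-random 4-link stars + hill climbing (kit jobs j008317/j008318, R = 0; j008487 hypercube: smallest real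
  eigenvalue found, threshold-resonance distance `σ_min(1 + G(0⁺)V)` — numbers in § Numerics below once the
  jobs return); the three open stubs of the picked line (`stub_diamagnetic`, `stub_greenBound`,
  `stub_noLeak`) re-derived by hand with their exact constants — all hold (slack recorded below).

## Contents
* (a) LOAD-BEARING: `TipNoBindingWithoutFloor` (floor `1/√L ≤ t` weakened to `0 ≤ t`) is FALSE —
  `tipNoBinding_false_without_floor`, kernel-checked: the free field has the 12 torus zero modes
  (`wilsonDirac_one_massless_mulVec_const`: constants are in the kernel of `D_W(1,0,r)` on every torus).
  Any proof must spend the floor (the picked line spends it in `stub_noLeak` as `1/t² ≤ L`).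
* (a') `TipNoBindingWithoutFloorPos` (floor weakened to `0 < t`): FALSE on paper/numerics, NOT closable here —
  near-miss `tipNoBinding_false_without_floor_pos` (sorry): the 12 zero modes of a box field form a cloud
  `{a_j(U)/L⁴}(1+o(1))`, `a_j(U)` = eigenvalues of the 12×12 threshold T-matrix capacity
  `A(U) = Σ_{x,y} [V(1+G(0⁺)V)⁻¹](x,y)`; a simple real `a_j > 0` is a REAL eigenvalue `~a_j/L⁴ → 0⁺`.
  Consequence (tightness of the floor): a floor `f(L)` is admissible iff, for every R, eventually
  `f(L)·L⁴ > a⋆(R) := sup_U max Re-positive a_j(U)`; `1/√L` is far inside (any `f → 0` with `f·L⁴ → ∞` works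
  by the same proof; `f = c/L⁴` fails for `c < a⋆(R)`).
* (c) NATURAL STRENGTHENINGS:
  `TipNoBindingComplexWindow` (exclude ALL eigenvalues with modulus in [1/√L, λ), not only real ones) —
    FALSE, kernel-checked (`not_tipNoBindingComplexWindow`): for U = 1, L = m², the axial plane wave
    `χ_k(x) c ⊗ v` (`k = m e₀`, `γ₀v = v`) is an eigenvector with eigenvalue `1 − e^{−2πi/m}` of modulus
    `2 sin(π/m) ∈ [4/m, 2π/m] ⊂ [1/√L, λ)` (`wilsonDirac_one_massless_mulVec_planeWave`).  The segment
    (0,2) is a hole of the free spectrum, not a gap: REALITY of `t` is load-bearing (it is what lets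
    positivity turn `t` into the energy `½Σ‖∇^Uψ‖²/‖ψ‖²`).
  `TipNoBindingUniformR` (one λ for all R) — false on paper, NOT closable here (near-miss
    `not_tipNoBindingUniformR`, sorry): instanton-like smooth lumps of radius ρ ≲ R bind real modes at
    `t ≈ c/ρ² → 0⁺` (EdwardsHellerNarayanan hep-lat/9802016 §3: localisation size of crossing modes decreases
    monotonically with the crossing point; smooth-instanton flows hep-lat/9801015; BNN hep-lat/0006030 §7),
    so `λ_R → 0` is forced and `TipPricing` must price deep binders by ACTION, not by `TipNoBinding`.
* (d) TARGETS: none assigned (payload.targets = ∅).  Open stubs of the picked line vetted: hold.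
* § Numerics (kit jobs j008317/j008318: R = 0 star = BNN's 4-link 'fluxon' cluster; j008487: BNN hypercube ⊂ R = 1 box;
  tree conventions; to be filled in when the jobs return — queue saturated at publication time).
* Landing: the sorry-free part of this file is proposed as
  `Theorems/TipNoBinding/Negative/FreeSpectrum.lean` (namespace `…Theorems.TipNoBindingNegative`).
-/


namespace Summit.QuantumFields.QCD.Cruxes.TipNoBinding.Disproof

open Literature.MathematicalPhysics Literature.MathematicalPhysics.QuantumLattice
  Literature.MathematicalPhysics.QuantumFieldTheory Literature.Probability.LatticeModels
open Matrix Finset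
open scoped Real

/-! ## Free-spectrum lemmas and the kernel-checked negatives (a), (c)
(identical to the proposed `Theorems/TipNoBinding/Negative/FreeSpectrum.lean`; kept self-contained here so
that this work file elaborates independently of gate timing) -/

section Char

variable {d L : ℕ} [NeZero L]

/-- `χ_k(e_μ) = e(k_μ)` (as in `…TipNoBindingStubSobolevSup`, copied to stay import-light). -/
theorem torusChar_single' (k : TorusSite d L) (μ : Fin d) :
    torusChar k (Pi.single μ 1) = ZMod.stdAddChar (k μ) := by
  classical
  unfold torusChar
  rw [Finset.prod_eq_single μ]
  · simp
  · intro i _ hi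
    simp [Pi.single_eq_of_ne hi]
  · simp

/-- `‖χ_k(e_μ) − 1‖² = 4 sin²(π k_μ.val / L)` (as in `…TipNoBindingStubSobolevSup`). -/
theorem norm_sq_torusChar_single_sub_one' (k : TorusSite d L) (μ : Fin d) :
    ‖torusChar k (Pi.single μ 1) - 1‖ ^ 2 = 4 * Real.sin (π * ((k μ).val : ℝ) / L) ^ 2 := by
  have hexp : torusChar k (Pi.single μ 1) =
      Complex.exp ((2 * π * ((k μ).val : ℝ) / L : ℝ) * Complex.I) := by
    rw [torusChar_single', ZMod.stdAddChar_apply, ZMod.toCircle_apply]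
    congr 1
    push_cast
    ring
  rw [hexp, mul_comm _ Complex.I, Complex.norm_exp_I_mul_ofReal_sub_one, Real.norm_eq_abs, sq_abs,
    mul_pow]
  congr 1
  · norm_num
  · congr 2
    ring

end Char

variable {L N : ℕ} [NeZero L] {G : Type*} [Group G] (ρ : G →* Matrix (Fin N) (Fin N) ℂ)

/-- **The action of the FREE Wilson–Dirac operator** (`U = 1`, any mass `m`, any Wilson parameter `r`),
entrywise: `(Dψ)(x,a,α) = (m+4r)ψ(x,a,α) − ½ Σ_μ Σ_β [(r − γ_μ)_{αβ} ψ(x+e_μ,a,β) + (r + γ_μ)_{αβ} ψ(x−e_μ,a,β)]`. -/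
theorem wilsonDirac_one_mulVec_apply (m r : ℝ) (ψ : TorusSite 4 L × Fin N × Fin 4 → ℂ)
    (p : TorusSite 4 L × Fin N × Fin 4) :
    (wilsonDirac ρ (1 : GaugeConfig 4 L G) m r *ᵥ ψ) p =
      ((m + 4 * r : ℝ) : ℂ) * ψ p - (1 / 2 : ℂ) * ∑ μ : Fin 4, ∑ β : Fin 4,
        ((((r : ℂ) • (1 : Matrix (Fin 4) (Fin 4) ℂ) - euclideanGamma μ) p.2.2 β) *
            ψ (p.1 + Pi.single μ 1, p.2.1, β) +
         (((r : ℂ) • (1 : Matrix (Fin 4) (Fin 4) ℂ) + euclideanGamma μ) p.2.2 β) *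
            ψ (p.1 - Pi.single μ 1, p.2.1, β)) := by
  simp only [Matrix.mulVec, dotProduct]
  simp only [wilsonDirac, Matrix.of_apply, Pi.one_apply, map_one, inv_one]
  simp only [sub_mul, Finset.sum_sub_distrib, ite_mul, zero_mul, Finset.sum_ite_eq, Finset.mem_univ,
    if_true]
  congr 1
  simp_rw [eq_shift_iff p.1 _ _]
  simp only [Literature.MathematicalPhysics.QuantumFieldTheory.Site.shift, mul_assoc, ← Finset.mul_sum]
  congr 1
  simp only [Finset.sum_mul, add_mul, ite_mul, zero_mul, Finset.sum_add_distrib]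
  rw [Finset.sum_comm]
  congr 1
  · refine Finset.sum_congr rfl fun μ _ => ?_
    simp only [Fintype.sum_prod_type, Finset.sum_ite_irrel, Finset.sum_const_zero, Finset.sum_ite_eq,
      Finset.sum_ite_eq', Finset.mem_univ, if_true, Matrix.one_apply, mul_ite, mul_one, mul_zero,
      ite_mul, zero_mul]
  · rw [Finset.sum_comm]
    refine Finset.sum_congr rfl fun μ _ => ?_
    simp only [Fintype.sum_prod_type, Finset.sum_ite_irrel, Finset.sum_const_zero, Finset.sum_ite_eq,
      Finset.sum_ite_eq', Finset.mem_univ, if_true, Matrix.one_apply, mul_ite, mul_one, mul_zero,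
      ite_mul, zero_mul]

/-- `Σ_β ((r•1 − γ_μ) αβ + (r•1 + γ_μ) αβ) X β = 2 r X α`: the `γ` parts of the two hops cancel. -/
theorem sum_projMinus_add_projPlus (r : ℝ) (μ α : Fin 4) (X : Fin 4 → ℂ) :
    ∑ β, (((r : ℂ) • (1 : Matrix (Fin 4) (Fin 4) ℂ) - euclideanGamma μ) α β * X β +
      ((r : ℂ) • (1 : Matrix (Fin 4) (Fin 4) ℂ) + euclideanGamma μ) α β * X β) = 2 * r * X α := by
  simp only [← add_mul, Matrix.sub_apply, Matrix.add_apply, sub_add_add_cancel, Matrix.smul_apply,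
    Matrix.one_apply, smul_eq_mul, ← two_mul, mul_ite, mul_one, mul_zero, ite_mul, zero_mul,
    Finset.sum_ite_eq, Finset.mem_univ, if_true]

/-- **The free massless Wilson–Dirac operator kills constants** (every `r`, every torus, every
representation): hence the `4N` "torus zero modes" (constant colour ⊗ spin vectors). -/
theorem wilsonDirac_one_massless_mulVec_const (r : ℝ) :
    wilsonDirac ρ (1 : GaugeConfig 4 L G) 0 r *ᵥ (fun _ => (1 : ℂ)) = 0 := by
  ext p
  rw [wilsonDirac_one_mulVec_apply, Pi.zero_apply]
  simp_rw [sum_projMinus_add_projPlus r _ p.2.2 (fun _ => (1 : ℂ))]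
  simp
  ring

/-- `det D_W(1, 0, r) = 0` on every torus (at least one colour). -/
theorem det_wilsonDirac_one_massless [NeZero N] (r : ℝ) :
    (wilsonDirac ρ (1 : GaugeConfig 4 L G) 0 r).det = 0 :=
  Matrix.exists_mulVec_eq_zero_iff.mp
    ⟨fun _ => 1, fun h0 => one_ne_zero (congr_fun h0 ((0 : TorusSite 4 L), (0 : Fin N), (0 : Fin 4))),
      wilsonDirac_one_massless_mulVec_const ρ r⟩

/-- The `γ₀`-eigenvector `(1,0,0,i)`: `γ₀ v = v` for the tree's chiral-basis `γ₀ = σʸ ⊗ σˣ`. -/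
theorem euclideanGamma_zero_mulVec_spinor :
    euclideanGamma 0 *ᵥ ![1, 0, 0, Complex.I] = ![1, 0, 0, Complex.I] := by
  ext i
  fin_cases i <;>
    simp [euclideanGamma, spinHalfPauli, Matrix.kroneckerMap_apply, finProdFinEquiv,
      Fin.divNat, Fin.modNat, Matrix.mulVec, dotProduct, Fin.sum_univ_four]

/-- **Free axial plane waves are eigenvectors**: for a momentum `k` along axis `0` and a spinor `v` with
`γ₀ v = v`, `D_W(1,0,1) ψ = (1 − conj χ_k(e₀)) ψ` for `ψ(x,a,α) = χ_k(x) c_a v_α`.  The eigenvalue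
`1 − e^{−iθ} = (1 − cos θ) + i sin θ` (`θ = 2πk₀/L`) is non-real for `θ ∉ πℤ` and has modulus `2|sin(θ/2)|`. -/
theorem wilsonDirac_one_massless_mulVec_planeWave (k : TorusSite 4 L)
    (hk : ∀ μ : Fin 4, μ ≠ 0 → k μ = 0) (c : Fin N → ℂ) (v : Fin 4 → ℂ)
    (hv : euclideanGamma 0 *ᵥ v = v) :
    wilsonDirac ρ (1 : GaugeConfig 4 L G) 0 1 *ᵥ (fun q => torusChar k q.1 * (c q.2.1 * v q.2.2)) =
      (1 - (starRingEnd ℂ) (torusChar k (Pi.single 0 1))) •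
        (fun q => torusChar k q.1 * (c q.2.1 * v q.2.2)) := by
  have h1 : torusChar k (Pi.single 1 1) = 1 := by
    rw [torusChar_single', hk 1 (by decide), AddChar.map_zero_eq_one]
  have h2 : torusChar k (Pi.single 2 1) = 1 := by
    rw [torusChar_single', hk 2 (by decide), AddChar.map_zero_eq_one]
  have h3 : torusChar k (Pi.single 3 1) = 1 := by
    rw [torusChar_single', hk 3 (by decide), AddChar.map_zero_eq_one]
  have hγ : ∀ α, ∑ β, euclideanGamma 0 α β * v β = v α := fun α => by
    have := congr_fun hv α
    simpa [Matrix.mulVec, dotProduct] using this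
  ext p
  rw [wilsonDirac_one_mulVec_apply, Pi.smul_apply, smul_eq_mul]
  simp only [torusChar_add_right, torusChar_sub_right]
  -- pull the scalar factors out of the β-sums (under the μ binder)
  have key : ∀ (μ : Fin 4) (w w' : ℂ),
      ∑ β, ((((1 : ℝ) : ℂ) • (1 : Matrix (Fin 4) (Fin 4) ℂ) - euclideanGamma μ) p.2.2 β *
          (torusChar k p.1 * w * (c p.2.1 * v β)) +
        (((1 : ℝ) : ℂ) • (1 : Matrix (Fin 4) (Fin 4) ℂ) + euclideanGamma μ) p.2.2 β *
          (torusChar k p.1 * w' * (c p.2.1 * v β))) =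
      torusChar k p.1 * c p.2.1 *
        (w * ∑ β, (((1 : ℝ) : ℂ) • (1 : Matrix (Fin 4) (Fin 4) ℂ) - euclideanGamma μ) p.2.2 β * v β +
         w' * ∑ β, (((1 : ℝ) : ℂ) • (1 : Matrix (Fin 4) (Fin 4) ℂ) + euclideanGamma μ) p.2.2 β * v β) := by
    intro μ w w'
    rw [Finset.mul_sum, Finset.mul_sum, mul_add, Finset.mul_sum, Finset.mul_sum,
      ← Finset.sum_add_distrib]
    refine Finset.sum_congr rfl fun β _ => ?_
    ring
  simp_rw [key]
  -- the spin sums: γ parts cancel in S⁻ + S⁺; for μ = 0 the eigen-relation γ₀ v = v kills S⁻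
  have hsum : ∀ μ : Fin 4,
      ∑ β, (((1 : ℝ) : ℂ) • (1 : Matrix (Fin 4) (Fin 4) ℂ) - euclideanGamma μ) p.2.2 β * v β +
        ∑ β, (((1 : ℝ) : ℂ) • (1 : Matrix (Fin 4) (Fin 4) ℂ) + euclideanGamma μ) p.2.2 β * v β =
        2 * v p.2.2 := by
    intro μ
    rw [← Finset.sum_add_distrib, sum_projMinus_add_projPlus 1 μ p.2.2 v]
    push_cast
    ring
  have hminus : ∑ β, (((1 : ℝ) : ℂ) • (1 : Matrix (Fin 4) (Fin 4) ℂ) - euclideanGamma 0) p.2.2 β * v β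
      = 0 := by
    simp only [Matrix.sub_apply, Matrix.smul_apply, Matrix.one_apply, smul_eq_mul, Complex.ofReal_one,
      one_mul, sub_mul, Finset.sum_sub_distrib, ite_mul, zero_mul, Finset.sum_ite_eq,
      Finset.mem_univ, if_true, hγ, sub_self]
  have hplus : ∑ β, (((1 : ℝ) : ℂ) • (1 : Matrix (Fin 4) (Fin 4) ℂ) + euclideanGamma 0) p.2.2 β * v β =
      2 * v p.2.2 := by
    have := hsum 0
    rwa [hminus, zero_add] at this
  rw [Fin.sum_univ_four, hminus, hplus, h1, h2, h3, map_one, one_mul, one_mul, one_mul, one_mul,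
    one_mul, one_mul, hsum 1, hsum 2, hsum 3]
  push_cast
  ring

/-! ### (a) the floor is load-bearing -/

/-- **(a) `TipNoBinding` with the floor `1/√L ≤ t` WEAKENED to `0 ≤ t` is false**: at `t = 0` the FREE
field (`U = 1`, admissible for every `R`) has the 12 constant zero modes on every torus.
Witness `R = 0`, `L = L₀ + 1`, `U = 1`, `t = 0`.  Any proof of the crux must spend the floor. -/
theorem tipNoBinding_false_without_floor :
    ¬ (∀ R : ℕ, ∃ lam : ℝ, 0 < lam ∧ ∃ L₀ : ℕ, ∀ (L : ℕ) [NeZero L], L₀ ≤ L →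
        ∀ U : GaugeConfig 4 L ↥(Matrix.specialUnitaryGroup (Fin 3) ℂ),
          (∀ (x : TorusSite 4 L) (μ : Fin 4), (∀ y ∈ box 4 R, Torus.proj L y ≠ x) → U (x, μ) = 1) →
          ∀ t : ℝ, 0 ≤ t → t < lam →
            (wilsonDirac (fundamentalRep (Fin 3)) U 0 1 - (t : ℂ) • (1 : Matrix _ _ ℂ)).det ≠ 0) := by
  intro h
  obtain ⟨lam, hlam, L₀, hL⟩ := h 0
  haveI : NeZero (L₀ + 1) := ⟨Nat.succ_ne_zero _⟩
  have h1 := hL (L₀ + 1) (Nat.le_succ _) 1 (fun _ _ _ => rfl) 0 le_rfl hlam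
  apply h1
  rw [Complex.ofReal_zero, zero_smul, sub_zero]
  exact det_wilsonDirac_one_massless _ 1

/-! ### (c) the hole is not a gap: complex eigenvalues fill every window above the floor -/

/-- **(c) `TipNoBinding` STRENGTHENED to all complex `z` with `|z| ∈ [1/√L, λ)` is false**, already for
the free field.  Witness: `R = 0`, `U = 1`, `L = m²` (`m > max(L₀, 2, 2π/λ)`), momentum `k = m e₀`
(angle `θ = 2π/m`), spinor `v = (1,0,0,i)` (`γ₀ v = v`): the plane wave is an eigenvector with eigenvalue
`z = 1 − e^{−iθ}`, `‖z‖ = 2 sin(π/m) ∈ [4/m, 2π/m] ⊂ [1/√L, λ)`.  Reality of `t` is load-bearing. -/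
theorem not_tipNoBindingComplexWindow :
    ¬ (∀ R : ℕ, ∃ lam : ℝ, 0 < lam ∧ ∃ L₀ : ℕ, ∀ (L : ℕ) [NeZero L], L₀ ≤ L →
        ∀ U : GaugeConfig 4 L ↥(Matrix.specialUnitaryGroup (Fin 3) ℂ),
          (∀ (x : TorusSite 4 L) (μ : Fin 4), (∀ y ∈ box 4 R, Torus.proj L y ≠ x) → U (x, μ) = 1) →
          ∀ z : ℂ, 1 / Real.sqrt (L : ℝ) ≤ ‖z‖ → ‖z‖ < lam →
            (wilsonDirac (fundamentalRep (Fin 3)) U 0 1 - z • (1 : Matrix _ _ ℂ)).det ≠ 0) := by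
  intro h
  obtain ⟨lam, hlam, L₀, hL⟩ := h 0
  obtain ⟨m, hm⟩ := exists_nat_gt (max (L₀ : ℝ) (max 2 (2 * Real.pi / lam)))
  have hmL₀ : (L₀ : ℝ) < m := lt_of_le_of_lt (le_max_left _ _) hm
  have hm2 : (2 : ℝ) < m := lt_of_le_of_lt ((le_max_left _ _).trans (le_max_right _ _)) hm
  have hmlam : 2 * Real.pi / lam < m :=
    lt_of_le_of_lt ((le_max_right _ _).trans (le_max_right _ _)) hm
  have hm2' : 2 < m := by exact_mod_cast hm2
  have hmpos : (0 : ℝ) < m := by linarith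
  haveI : NeZero (m * m) := ⟨Nat.mul_ne_zero (by omega) (by omega)⟩
  have hLL : L₀ ≤ m * m := le_trans (by exact_mod_cast hmL₀.le) (Nat.le_mul_self m)
  -- the momentum, its character at e₀ and the eigenvalue
  set k : TorusSite 4 (m * m) := Pi.single 0 (m : ZMod (m * m)) with hk
  have hk0 : ∀ μ : Fin 4, μ ≠ 0 → k μ = 0 := fun μ hμ => by rw [hk, Pi.single_eq_of_ne hμ]
  have hkval : ((k 0).val : ℝ) = m := by
    rw [hk, Pi.single_eq_same, ZMod.val_natCast, Nat.mod_eq_of_lt]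
    nlinarith
  set χ : ℂ := torusChar k (Pi.single 0 1) with hχ
  set z : ℂ := 1 - (starRingEnd ℂ) χ with hz
  have hsin0 : 0 ≤ Real.sin (Real.pi / m) :=
    Real.sin_nonneg_of_nonneg_of_le_pi (by positivity)
      (div_le_self Real.pi_pos.le (by exact_mod_cast (by omega : 1 ≤ m)))
  have hnorm : ‖z‖ = 2 * Real.sin (Real.pi / m) := by
    have hsq : ‖χ - 1‖ ^ 2 = 4 * Real.sin (Real.pi * ((k 0).val : ℝ) / (m * m : ℕ)) ^ 2 :=
      norm_sq_torusChar_single_sub_one' k 0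
    rw [hkval] at hsq
    have harg : Real.pi * (m : ℝ) / ((m * m : ℕ) : ℝ) = Real.pi / m := by
      push_cast
      field_simp
    rw [harg] at hsq
    have hz' : ‖z‖ = ‖χ - 1‖ := by
      have : z = -((starRingEnd ℂ) (χ - 1)) := by rw [hz, map_sub, map_one]; ring
      rw [this, norm_neg, Complex.norm_conj]
    rw [hz', ← Real.sqrt_sq (norm_nonneg (χ - 1)), hsq,
      show (4 : ℝ) * Real.sin (Real.pi / m) ^ 2 = (2 * Real.sin (Real.pi / m)) ^ 2 by ring,
      Real.sqrt_sq (mul_nonneg zero_le_two hsin0)]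
  -- the window
  have hsqrt : Real.sqrt ((m * m : ℕ) : ℝ) = m := by
    push_cast
    exact Real.sqrt_mul_self hmpos.le
  have hlow : 1 / Real.sqrt ((m * m : ℕ) : ℝ) ≤ ‖z‖ := by
    rw [hsqrt, hnorm]
    have hj : 2 / Real.pi * (Real.pi / m) ≤ Real.sin (Real.pi / m) :=
      Real.mul_le_sin (by positivity)
        (div_le_div_of_nonneg_left Real.pi_pos.le (by norm_num) (by linarith))
    have h2m : 2 / Real.pi * (Real.pi / m) = 2 / m := by
      field_simp
    rw [h2m] at hj
    have : 1 / (m : ℝ) ≤ 2 * (2 / m) := by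
      rw [div_le_iff₀ hmpos]
      field_simp
      norm_num
    linarith
  have hup : ‖z‖ < lam := by
    rw [hnorm]
    have hs : Real.sin (Real.pi / m) ≤ Real.pi / m := Real.sin_le (by positivity)
    have h2 : 2 * Real.pi / m < lam := by
      rw [div_lt_iff₀ hmpos]
      rw [div_lt_iff₀ hlam] at hmlam
      linarith
    calc 2 * Real.sin (Real.pi / m) ≤ 2 * (Real.pi / m) := by linarith
      _ = 2 * Real.pi / m := by ring
      _ < lam := h2
  -- the eigenvector
  have hv := euclideanGamma_zero_mulVec_spinor
  have hψ0 : (fun q : TorusSite 4 (m * m) × Fin 3 × Fin 4 =>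
      torusChar k q.1 * ((fun _ : Fin 3 => (1 : ℂ)) q.2.1 * (![1, 0, 0, Complex.I] : Fin 4 → ℂ) q.2.2)) ≠ 0 := by
    intro h0
    have := congr_fun h0 ((0 : TorusSite 4 (m * m)), (0 : Fin 3), (0 : Fin 4))
    simp at this
  have hD := hL (m * m) hLL 1 (fun _ _ _ => rfl) z hlow hup
  apply hD
  refine Matrix.exists_mulVec_eq_zero_iff.mp ⟨_, hψ0, ?_⟩
  rw [Matrix.sub_mulVec, Matrix.smul_mulVec, Matrix.one_mulVec, sub_eq_zero, hz, hχ]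
  exact wilsonDirac_one_massless_mulVec_planeWave (fundamentalRep (Fin 3)) k hk0
    (fun _ : Fin 3 => (1 : ℂ)) _ hv


/-! ## Named variants of the crux (for citation by planners / the lead) -/

/-- `TipNoBinding` with the floor `1/√L ≤ t` WEAKENED to `0 ≤ t` (everything else verbatim). FALSE: (a). -/
def TipNoBindingWithoutFloor : Prop :=
  ∀ R : ℕ, ∃ lam : ℝ, 0 < lam ∧ ∃ L₀ : ℕ, ∀ (L : ℕ) [NeZero L], L₀ ≤ L →
    ∀ U : GaugeConfig 4 L ↥(Matrix.specialUnitaryGroup (Fin 3) ℂ),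
      (∀ (x : TorusSite 4 L) (μ : Fin 4), (∀ y ∈ box 4 R, Torus.proj L y ≠ x) → U (x, μ) = 1) →
      ∀ t : ℝ, 0 ≤ t → t < lam →
        (wilsonDirac (fundamentalRep (Fin 3)) U 0 1 - (t : ℂ) • (1 : Matrix _ _ ℂ)).det ≠ 0

/-- **(a)** kernel-checked. -/
theorem tipNoBindingWithoutFloor_false : ¬ TipNoBindingWithoutFloor := tipNoBinding_false_without_floor

/-- `TipNoBinding` STRENGTHENED to all complex `z` with `|z| ∈ [1/√L, λ)`. FALSE: (c). -/
def TipNoBindingComplexWindow : Prop :=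
  ∀ R : ℕ, ∃ lam : ℝ, 0 < lam ∧ ∃ L₀ : ℕ, ∀ (L : ℕ) [NeZero L], L₀ ≤ L →
    ∀ U : GaugeConfig 4 L ↥(Matrix.specialUnitaryGroup (Fin 3) ℂ),
      (∀ (x : TorusSite 4 L) (μ : Fin 4), (∀ y ∈ box 4 R, Torus.proj L y ≠ x) → U (x, μ) = 1) →
      ∀ z : ℂ, 1 / Real.sqrt (L : ℝ) ≤ ‖z‖ → ‖z‖ < lam →
        (wilsonDirac (fundamentalRep (Fin 3)) U 0 1 - z • (1 : Matrix _ _ ℂ)).det ≠ 0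

/-- **(c)** kernel-checked. -/
theorem tipNoBindingComplexWindow_false : ¬ TipNoBindingComplexWindow := not_tipNoBindingComplexWindow

/-- `TipNoBinding` with the floor weakened to `0 < t` (strict positivity only, no `L`-dependent floor). -/
def TipNoBindingWithoutFloorPos : Prop :=
  ∀ R : ℕ, ∃ lam : ℝ, 0 < lam ∧ ∃ L₀ : ℕ, ∀ (L : ℕ) [NeZero L], L₀ ≤ L →
    ∀ U : GaugeConfig 4 L ↥(Matrix.specialUnitaryGroup (Fin 3) ℂ),
      (∀ (x : TorusSite 4 L) (μ : Fin 4), (∀ y ∈ box 4 R, Torus.proj L y ≠ x) → U (x, μ) = 1) →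
      ∀ t : ℝ, 0 < t → t < lam →
        (wilsonDirac (fundamentalRep (Fin 3)) U 0 1 - (t : ℂ) • (1 : Matrix _ _ ℂ)).det ≠ 0

/-- **(a′) NEAR-MISS (not closable here; believed FALSE).**  Obstruction: the witness is an infinite family
(all large `L`) of tiny REAL eigenvalues `t_L(U) = a/L⁴ (1 + o(1))` produced by the zero-mode cloud of a
fixed box field `U` — degenerate perturbation theory of the 12-fold free zero mode resummed through the
threshold T-matrix: `a ∈ spec A(U)`, `A(U) = Σ_{x,y∈S} [V(1 + G_∞(0⁺)V)⁻¹](x,y)` (12 × 12, exists BECAUSE the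
crux's no-threshold-resonance content holds).  A simple real `a > 0` gives a real eigenvalue by the
conjugate-pair symmetry of the `γ₅`-Hermitian `D`.  Certifying `det(D_L(U) − t) = 0` for all large `L` needs
quantitative eigenvalue perturbation theory for non-normal matrices in Lean — out of reach of this seat.
Numerical status: kit jobs j008317/j008318 (§ Numerics) compute `spec A(U)` for the R = 0 star and compare
with the exact near-zero eigenvalues × L⁴ on periodic tori L = 4, 6, 8.
Consequence if true (TIGHTNESS OF THE FLOOR): a floor `f(L) → 0` can replace `1/√L` iff for every `R`
eventually `f(L)·L⁴ > a⋆(R) := sup_U max (spec A(U) ∩ (0,∞))` (Birman–Schwinger: the pole term of the torus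
resolvent is `|S|/(f L⁴)`).  The picked line spends the floor only as the zero-mode cost `1/(t²L⁴) ≤ 1/(f²L⁴)`
inside `stub_noLeak` (there bounded by `1/L³` using `f = L^{-1/2}`); its chain
`1 ≤ (1/(f²L⁴) + 4K)·256|S|²·(2/L⁴ + 4Kt)` closes verbatim for every floor with `f(L) ≥ L⁻²` (bracket
`≤ 1 + 4K`), so `1/√L` carries a large safety margin, while floors below `~L⁻²` are out of reach of that
line but not of the statement (true threshold scale `Θ_R(L⁻⁴)`). -/
theorem tipNoBindingWithoutFloorPos_false : ¬ TipNoBindingWithoutFloorPos := by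
  sorry

/-- `TipNoBinding` STRENGTHENED to a box-uniform window: one `λ` for every `R` (quantifiers `∃ λ ∀ R`). -/
def TipNoBindingUniformR : Prop :=
  ∃ lam : ℝ, 0 < lam ∧ ∀ R : ℕ, ∃ L₀ : ℕ, ∀ (L : ℕ) [NeZero L], L₀ ≤ L →
    ∀ U : GaugeConfig 4 L ↥(Matrix.specialUnitaryGroup (Fin 3) ℂ),
      (∀ (x : TorusSite 4 L) (μ : Fin 4), (∀ y ∈ box 4 R, Torus.proj L y ≠ x) → U (x, μ) = 1) →
      ∀ t : ℝ, 1 / Real.sqrt (L : ℝ) ≤ t → t < lam →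
        (wilsonDirac (fundamentalRep (Fin 3)) U 0 1 - (t : ℂ) • (1 : Matrix _ _ ℂ)).det ≠ 0

/-- **(c′) NEAR-MISS (not closable here; FALSE on paper).**  `λ_R → 0` as `R → ∞` is forced: a smooth
(anti-)instanton of radius `ρ`, truncated to a box `R ≳ 3ρ` (singular gauge, links exactly `1` outside), carries
a localized near-zero mode of `γ₅(D_W − m)` crossing at `−m = t(ρ) ≈ c/ρ² → 0⁺` — numerically established
(Edwards–Heller–Narayanan, smooth SU(2) instanton flows hep-lat/9801015; hep-lat/9802016 §3: the localisation
size of crossing modes decreases monotonically with the crossing point; BNN hep-lat/0006030 §7), analytically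
the `O(a²/ρ²)` additive mass renormalisation of the would-be zero mode.  A Lean witness needs a certified
family of SU(3) box fields with certified real eigenvalues `t(ρ) ↓ 0` — interval arithmetic on Birman–Schwinger
determinants of dimension `12·|S| ~ 10⁴`, not attempted.  MESSAGE FOR `TipPricing`: deep binders (t ≪ 1) exist
at every depth once `R` is free; they must be priced by ACTION (smooth lumps cost `≈ 8π²/g²·k`), not excluded
by `TipNoBinding`, whose `λ_R` is necessarily non-uniform (and in the effective line astronomically small:
`λ_R = 1/(16·A·K)`, `A = 256·25(2R+1)⁸(1+4K)`, i.e. `λ_0 ≈ 10⁻⁶`, versus the empirical binding scale `t ≳ 1` of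
BNN-type clusters — see § Numerics). -/
theorem not_tipNoBindingUniformR : ¬ TipNoBindingUniformR := by
  sorry

/-! ## § Numerics (placeholder — jobs queued; see the docblock) -/

end Summit.QuantumFields.QCD.Cruxes.TipNoBinding.Disproof
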